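import Literature.AnabelianGeometry.EtaleTheta.Discharge.Sec3Thm37RatStdOfLine
import Literature.AnabelianGeometry.EtaleTheta.Discharge.Sec3Thm37RatStdOfCnst
import Literature.AnabelianGeometry.EtaleTheta.TemperedFrobenioidLaws
import HarnessLib

/-!
# [EtTh] Theorem 3.7 (ii) — NODE CLOSER: both printed sentences as ONE theorem in print's shape, in the
# tree's REAL [FrdI] vocabulary and AS TYPED (`TemperedFrobenioid.Thm37_ii`) at facade reading slots

S. Mochizuki, *The étale theta function and its Frobenioid-theoretic manifestations*, Publ. RIMS **45**
(2009) [EtTh], §3, Theorem 3.7 (ii): statement PDF p. 79 (printed p. 305) ll. 32–34, proof PDF p. 80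
(printed p. 306) ll. 15–22 of `paper:doi-10-2977-prims-1234361159` [cite: MochizukiEtTh2009, Thm 3.7 (ii) p.79]:

> "(ii) Suppose `D` is of FSMFF-type, and that `Φ` is non-dilating. Then `C` is of standard type. If,
> moreover, `Φ` is rational [cf. Definition 3.6, (ii)], then `C` is of rationally standard type."
> Proof: "… since `Π^tp_X` acts trivially on `K^×/O_K^×`, it follows [cf. also the condition imposed on `F`
> in Definition 3.6, (ii), (b)] that every object of `(C^un-tr)^birat` is Frobenius-compact. Thus, assertion
> (ii) follows immediately from the definitions."

Proof-only companion (theorems only: no `def`, no `Prop` fact, no instance; abc-iut cell, layer L2, cone node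
**`EtTh:Thm3.7(ii)`**, holder abc-iut-w4-d103; R-C «per-node clause coverage»).  Nothing landed is edited or
restated: every sentence-level closer already exists — sentence 1 = `isOfStandardType_treeCatVocab`
(`Sec3Thm37Standard`, p413076), sentence 2 = `thm37_ii_ratStd_treeCatVocab'` (`Sec3Thm37RatStd`, abc-iut-w5-d250
p422512) with print's proof step "`Π^tp_X` acts trivially on `K^×/O_K^×`" either as the literal binder `hKfix`
or DERIVED (`…_of_line'`, p428235: `ℤ`-monoprime `Φ^{bs-fld}` + the constant line `hLine`/`hInt`; `…_of_cnst'`,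
p428877: `Prop34Cnst` + `hLine`/`hInt` + torsion automorphism groups of `D^cnst`).  THIS FILE assembles them
into the node's own shape `hD → hnd → (sentence 1 ∧ (hrat → sentence 2))` — print's two hypotheses and
print's "if, moreover" as antecedents, NOT as residual binders — so that the node's residual is read off ONE
signature:

* §1 `thm37_ii_node (hBmon) (hKfix)` — real vocabulary, any monoid type; residual = {`hBmon` ([FrdI] Thm 5.2
  preamble «`𝔹` a monoid on `D`», the well-formedness claim inside Def. 3.6 (ii) «one verifies … a model
  Frobenioid»), `hKfix` (print's own proof sentence, p. 306 l.18–19)};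
  `thm37_ii_node_of_line` — `hKfix` ⟸ {`hLine`, `hInt`, `hZ` : `Φ^{bs-fld}` `ℤ`-monoprime} (Def. 3.6 (i)/(ii)(a)
  data clauses, abc-iut-w5-d250); `thm37_ii_node_of_cnst` — `hKfix` ⟸ {`P : Prop34Cnst T cnst`, `hLine`, `hInt`,
  `hfin`} (print's route through `Aut_{D^cnst}(A^cnst)`); `thm37_ii_node_of_baseInj` — `hBmon` ⟸ the structure
  owner's NAMED LAW `TemperedFrobenioid.BaseInj` (abc-iut-L2-t3, `TemperedFrobenioidLaws`, census A9) + «FSM-morphisms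
  of `D` are isomorphisms» (`isMonoidOn_ratFnFunctor_of_baseInj'`).
* §2 AS TYPED.  abc-iut-L2-t3's typed node statement `TemperedFrobenioid.Thm37_ii C₀ F` quantifies over a
  hypothesis VOCABULARY `F : FrobenioidFacade D` whose fields "of standard type" / "of rationally standard type"
  are FREE predicates, and reads "`Φ` rational" through the free vocabulary parameter `IsRational` of
  `treeCatVocab`; its universal closure is refuted in the tree (`TemperedFrobenioid.not_forall_thm37_ii`,
  `Sec3PropsSchemaClosures`).  `thm37_ii_of_slots` inhabits `C₀.Thm37_ii F` — over BOTH canonical vocabularies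
  (`treeMonoidVocab`, so that the typed non-dilating hypothesis IS the tree's `IsNonDilatingOn`, p413076's
  `isNonDilatingOn_iff_pull`; `treeCatVocab`) — at every facade whose two Def. 3.1 (i) / 4.5 (iii) fields are
  implied AT `C₀` by the tree's real [FrdI] predicates (reading slots `hStd`, `hRS`) and every vocabulary whose
  "rational" implies [FrdI] Def. 4.5 (ii) rationality of the objects (`hRat` — Def. 3.6 (ii): "if `C` is of
  rational … type [a property which is completely determined by `Φ` — cf. [FrdI], Definition 4.5, (ii)], then we
  shall say that `Φ` is rational"), from {`hBmon`, `hKfix`}; `thm37_ii_of_slots_of_line` /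
  `thm37_ii_of_slots_of_laws` with `hKfix` resp. `hBmon` replaced as in §1.  This is the (ii)-analogue of
  `thm37_iii_withCnst` (the typed (iii) at the instantiated facade, `Sec3Thm37Cnst`).

HONEST FRAMING: refereed pre-IUT material ([EtTh] §3 over [FrdI] §§3–5); bookkeeping over PROVED rows, no new
mathematics; the residual binders are properties of the abstract Def. 3.3 (iii) / 3.6 (i)–(ii) data that the
typed interface does not record (each has a kernel countermodel or a constructed model in the tree, cf.
`TemperedFrobenioidLaws`), dischargeable only at instantiated data; nothing here bears on [IUTchIII] Cor. 3.12;
no statement of either paper is strengthened; typed ≠ proved — here PROVED modulo the literal binders.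
-/

namespace Literature.AnabelianGeometry.EtaleTheta

open CategoryTheory Opposite Literature.AlgebraicGeometry.Frobenioids

namespace TemperedFrobenioid

universe u₀ v₀ u₁ v₁ u v w

/-! ### §1 The node in print's shape, real [FrdI] vocabulary, canonical category vocabulary `treeCatVocab` -/

section TreeVocab

variable {D₀ : Type u₀} [Category.{v₀} D₀] {V : FrdIMonoidStub.{w}}
  {T : RealifiedDivisorMonoids (D₀ := D₀) V} {D : Type u} [Category.{v} D]
  {IsRational IsStrictlyRational : (Dᵒᵖ ⥤ CommMonCat.{w}) → Prop}
  (C₀ : TemperedFrobenioid T D (treeCatVocab D IsRational IsStrictlyRational))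

/-- **[EtTh] Thm 3.7 (ii) — the node in print's shape** (any monoid type `Λ`): for the tempered Frobenioid `C`
(the model Frobenioid of the Def. 3.6 (ii) data) over the canonical vocabulary, GIVEN `hBmon` ([FrdI] Thm 5.2
preamble) and print's proof sentence `hKfix` ("`Π^tp_X` acts trivially on `K^×/O_K^×`": pull-backs along the
automorphisms of `A` in `D` fix the divisors of CONSTANT rational functions): if `D` is of FSMFF-type and `Φ` is
non-dilating then (sentence 1) `C` is of standard type ([FrdI] Def. 3.1 (i), `PreFrobenioidData.IsOfStandardType`
at the model data) AND (sentence 2) if moreover every object is rational ([FrdI] Def. 4.5 (ii) at THE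
birationalization and THE support — Def. 3.6 (ii)'s meaning of "`Φ` rational") then `C` is of rationally standard
type ([FrdI] Def. 4.5 (iii) at `PreFrobenioid.rsParams`).  Composition of `isOfStandardType_treeCatVocab` (p413076)
and `thm37_ii_ratStd_treeCatVocab'` (p422512). [cite: MochizukiEtTh2009, Thm 3.7 (ii) p.79] -/
theorem thm37_ii_node (hBmon : IsMonoidOn C₀.ratFnFunctor)
    (hKfix : ∀ (A : D) (f : A ≅ A) (b : T.BΛ.obj (C₀.baseOp (op A)))
      (ξ : Algebra.GrothendieckGroup (C₀.Φ.carrier (op A))),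
      b ∈ T.FΛ (C₀.baseOp (op A)) → (b, ξ) ∈ C₀.ratFn (op A) → pullGp C₀.divisorMonoid f.hom ξ = ξ) :
    IsOfFSMFFType D → IsNonDilatingOn C₀.divisorMonoid →
      (ModelFrobenioid.data C₀.divisorMonoid C₀.ratFnFunctor C₀.divBNatTrans).IsOfStandardType ∧
      ((∀ X : C₀.category,
          PreFrobenioidData.IsRational
            (PreFrobenioid.biratData (C₀.isFrobenioid_treeCatVocab_of_isMonoidOn hBmon)
              (PreFrobenioid.hasBiratSquares_of_isFrobenioid (C₀.isFrobenioid_treeCatVocab_of_isMonoidOn hBmon)))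
            (S := PreFrobenioidData.ofFunctor C₀.divisorMonoid C₀.toElem) (fun a 𝔭 => PrimarySupp a 𝔭) X) →
        (PreFrobenioidData.ofFunctor C₀.divisorMonoid C₀.toElem).IsOfRationallyStandardType
          (PreFrobenioid.rsParams (C₀.isFrobenioid_treeCatVocab_of_isMonoidOn hBmon) fun a 𝔭 => PrimarySupp a 𝔭)) :=
  fun hD hnd =>
    ⟨C₀.isOfStandardType_treeCatVocab hBmon hD hnd,
      fun hrat => C₀.thm37_ii_ratStd_treeCatVocab' hBmon hD hnd hrat hKfix⟩

/-- **The node with print's proof sentence DERIVED at `ℤ`-monoprime `Φ^{bs-fld}`** (the `Λ = ℤ` flavour of Def. 3.6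
(ii)(a); abc-iut-w5-d250's `pullGp_cnst_eq_self_of_line_of_isZMonoprime`, p428235): residual = {`hBmon`; `hLine`
(every element of the constant line `ℝ·Φ₀^cnst(Y)` is effective or anti-effective), `hInt` (`Φ₀^ℝ(Y)` integral),
`hZ` (`Φ^{bs-fld}(A)` `ℤ`-monoprime at every `A`)} — clauses of the Def. 3.3 (iii) / 3.6 (i)–(ii)(a) data, no
automorphism-invariance input. [cite: MochizukiEtTh2009, Thm 3.7 (ii) p.79] -/
theorem thm37_ii_node_of_line (hBmon : IsMonoidOn C₀.ratFnFunctor)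
    (hLine : ∀ (Y : D₀ᵒᵖ) (g : Algebra.GrothendieckGroup (T.ΦR.obj Y)), g ∈ T.cnstR Y →
      ∃ r : T.ΦR.obj Y, g = Algebra.GrothendieckGroup.of r ∨ g = (Algebra.GrothendieckGroup.of r)⁻¹)
    (hInt : ∀ Y : D₀ᵒᵖ, IsCancelMul (T.ΦR.obj Y))
    (hZ : ∀ A : D, IsZMonoprime (C₀.bsFld.carrier (op A))) :
    IsOfFSMFFType D → IsNonDilatingOn C₀.divisorMonoid →
      (ModelFrobenioid.data C₀.divisorMonoid C₀.ratFnFunctor C₀.divBNatTrans).IsOfStandardType ∧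
      ((∀ X : C₀.category,
          PreFrobenioidData.IsRational
            (PreFrobenioid.biratData (C₀.isFrobenioid_treeCatVocab_of_isMonoidOn hBmon)
              (PreFrobenioid.hasBiratSquares_of_isFrobenioid (C₀.isFrobenioid_treeCatVocab_of_isMonoidOn hBmon)))
            (S := PreFrobenioidData.ofFunctor C₀.divisorMonoid C₀.toElem) (fun a 𝔭 => PrimarySupp a 𝔭) X) →
        (PreFrobenioidData.ofFunctor C₀.divisorMonoid C₀.toElem).IsOfRationallyStandardType
          (PreFrobenioid.rsParams (C₀.isFrobenioid_treeCatVocab_of_isMonoidOn hBmon) fun a 𝔭 => PrimarySupp a 𝔭)) :=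
  C₀.thm37_ii_node hBmon fun A =>
    C₀.pullGp_cnst_eq_self_of_line_of_isZMonoprime A hLine hInt (hZ A)

/-- **The node with print's proof sentence DERIVED along print's own route through `Aut_{D^cnst}(A^cnst)`** (any
monoid type; abc-iut-w5-d250's `pullGp_cnst_eq_self_of_line_of_cnst`, p428877): residual = {`hBmon`;
`P : Prop34Cnst T cnst` (Prop. 3.4 (ii) relative to `D₀ → D^cnst = B(Spec K)⁰`), `hLine`, `hInt`, `hfin` (every
`Aut_{D^cnst}(Z)` is a torsion group — print: every `Aut(L/K)` is finite)}. [cite: MochizukiEtTh2009, Thm 3.7 (ii) p.79] -/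
theorem thm37_ii_node_of_cnst {Dcnst : Type u₁} [Category.{v₁} Dcnst] {cnst : D₀ ⥤ Dcnst}
    (hBmon : IsMonoidOn C₀.ratFnFunctor) (P : T.Prop34Cnst cnst)
    (hLine : ∀ (Y : D₀ᵒᵖ) (g : Algebra.GrothendieckGroup (T.ΦR.obj Y)), g ∈ T.cnstR Y →
      ∃ r : T.ΦR.obj Y, g = Algebra.GrothendieckGroup.of r ∨ g = (Algebra.GrothendieckGroup.of r)⁻¹)
    (hInt : ∀ Y : D₀ᵒᵖ, IsCancelMul (T.ΦR.obj Y))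
    (hfin : ∀ (Z : Dcnst) (φ : Aut Z), IsOfFinOrder φ) :
    IsOfFSMFFType D → IsNonDilatingOn C₀.divisorMonoid →
      (ModelFrobenioid.data C₀.divisorMonoid C₀.ratFnFunctor C₀.divBNatTrans).IsOfStandardType ∧
      ((∀ X : C₀.category,
          PreFrobenioidData.IsRational
            (PreFrobenioid.biratData (C₀.isFrobenioid_treeCatVocab_of_isMonoidOn hBmon)
              (PreFrobenioid.hasBiratSquares_of_isFrobenioid (C₀.isFrobenioid_treeCatVocab_of_isMonoidOn hBmon)))
            (S := PreFrobenioidData.ofFunctor C₀.divisorMonoid C₀.toElem) (fun a 𝔭 => PrimarySupp a 𝔭) X) →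
        (PreFrobenioidData.ofFunctor C₀.divisorMonoid C₀.toElem).IsOfRationallyStandardType
          (PreFrobenioid.rsParams (C₀.isFrobenioid_treeCatVocab_of_isMonoidOn hBmon) fun a 𝔭 => PrimarySupp a 𝔭)) :=
  C₀.thm37_ii_node hBmon fun A f b ξ hb hbξ =>
    C₀.pullGp_cnst_eq_self_of_line_of_cnst P A hLine hInt f (hfin _ _) b ξ hb hbξ

/-- **The node with `hBmon` supplied by the structure owner's NAMED LAW** `TemperedFrobenioid.BaseInj` (census A9:
pull-backs of `B₀^Λ` along the images of the morphisms of `D` are injective — abc-iut-L2-t3, `TemperedFrobenioidLaws`)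
and «FSM-morphisms of `D` are isomorphisms» ([FrdI] Def. 1.1 (ii)(b); a theorem at the genuine base
`B^temp(Π)⁰`, [FrdII] Ex. 1.3 (i)), via `isMonoidOn_ratFnFunctor_of_baseInj'`; `hKfix` literal.
[cite: MochizukiEtTh2009, Thm 3.7 (ii) p.79] -/
theorem thm37_ii_node_of_baseInj (hB : C₀.BaseInj) (hFSM : ∀ {A B : D} (α : B ⟶ A), IsFSM α → IsIso α)
    (hKfix : ∀ (A : D) (f : A ≅ A) (b : T.BΛ.obj (C₀.baseOp (op A)))
      (ξ : Algebra.GrothendieckGroup (C₀.Φ.carrier (op A))),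
      b ∈ T.FΛ (C₀.baseOp (op A)) → (b, ξ) ∈ C₀.ratFn (op A) → pullGp C₀.divisorMonoid f.hom ξ = ξ) :
    IsOfFSMFFType D → IsNonDilatingOn C₀.divisorMonoid →
      (ModelFrobenioid.data C₀.divisorMonoid C₀.ratFnFunctor C₀.divBNatTrans).IsOfStandardType ∧
      ((∀ X : C₀.category,
          PreFrobenioidData.IsRational
            (PreFrobenioid.biratData
              (C₀.isFrobenioid_treeCatVocab_of_isMonoidOn (C₀.isMonoidOn_ratFnFunctor_of_baseInj' hB hFSM))
              (PreFrobenioid.hasBiratSquares_of_isFrobenioid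
                (C₀.isFrobenioid_treeCatVocab_of_isMonoidOn (C₀.isMonoidOn_ratFnFunctor_of_baseInj' hB hFSM))))
            (S := PreFrobenioidData.ofFunctor C₀.divisorMonoid C₀.toElem) (fun a 𝔭 => PrimarySupp a 𝔭) X) →
        (PreFrobenioidData.ofFunctor C₀.divisorMonoid C₀.toElem).IsOfRationallyStandardType
          (PreFrobenioid.rsParams
            (C₀.isFrobenioid_treeCatVocab_of_isMonoidOn (C₀.isMonoidOn_ratFnFunctor_of_baseInj' hB hFSM))
            fun a 𝔭 => PrimarySupp a 𝔭)) :=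
  C₀.thm37_ii_node (C₀.isMonoidOn_ratFnFunctor_of_baseInj' hB hFSM) hKfix

end TreeVocab

/-! ### §2 AS TYPED: `TemperedFrobenioid.Thm37_ii C₀ F` at facade reading slots, both vocabularies canonical -/

section AsTyped

variable {D₀ : Type u₀} [Category.{v₀} D₀] {T : RealifiedDivisorMonoids (D₀ := D₀) treeMonoidVocab.{w}}
  {D : Type u} [Category.{v} D] {IsRational IsStrictlyRational : (Dᵒᵖ ⥤ CommMonCat.{w}) → Prop}
  (C₀ : TemperedFrobenioid T D (treeCatVocab D IsRational IsStrictlyRational))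

/-- **[EtTh] Thm 3.7 (ii) AS TYPED** (abc-iut-L2-t3's `Thm37_ii`, p407532) **at facade reading slots.**  Over the
canonical monoid vocabulary `treeMonoidVocab` ("non-dilating" = the tree's `IsNonDilating`, so the typed hypothesis
`∀ (A : Dᵒᵖ) (f : A ⟶ A), V.IsNonDilating (Φ(A)) (Φ.pull f)` IS `IsNonDilatingOn Φ`, `isNonDilatingOn_iff_pull`) and
the canonical category vocabulary `treeCatVocab D IsRational IsStrictlyRational`: for every hypothesis vocabulary
`F : FrobenioidFacade D` whose field "of standard type" is implied AT `C₀` by [FrdI] Def. 3.1 (i) at the model data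
(`hStd`) and whose field "of rationally standard type" is implied AT `C₀` by [FrdI] Def. 4.5 (iii) at THE parameters
(`hRS`), and every reading of the vocabulary's "`Φ` rational" that implies [FrdI] Def. 4.5 (ii) rationality of the
objects (`hRat`; Def. 3.6 (ii): "`Φ` rational" MEANS "`C` of rational type"), the typed statement
`C₀.Thm37_ii F` HOLDS, given `hBmon` and print's proof sentence `hKfix`.  The free-slot schema itself is refuted as
a universal closure (`not_forall_thm37_ii`); this is its inhabitant at every honest slot — the (ii)-analogue of
`thm37_iii_withCnst`. [cite: MochizukiEtTh2009, Thm 3.7 (ii) p.79] -/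
theorem thm37_ii_of_slots (F : FrobenioidFacade.{u, v, w} D) (hBmon : IsMonoidOn C₀.ratFnFunctor)
    (hStd : (ModelFrobenioid.data C₀.divisorMonoid C₀.ratFnFunctor C₀.divBNatTrans).IsOfStandardType →
      F.IsOfStandardType C₀.toElem)
    (hRS : (PreFrobenioidData.ofFunctor C₀.divisorMonoid C₀.toElem).IsOfRationallyStandardType
        (PreFrobenioid.rsParams (C₀.isFrobenioid_treeCatVocab_of_isMonoidOn hBmon) fun a 𝔭 => PrimarySupp a 𝔭) →
      F.IsOfRationallyStandardType C₀.toElem)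
    (hRat : C₀.IsRational → ∀ X : C₀.category,
      PreFrobenioidData.IsRational
        (PreFrobenioid.biratData (C₀.isFrobenioid_treeCatVocab_of_isMonoidOn hBmon)
          (PreFrobenioid.hasBiratSquares_of_isFrobenioid (C₀.isFrobenioid_treeCatVocab_of_isMonoidOn hBmon)))
        (S := PreFrobenioidData.ofFunctor C₀.divisorMonoid C₀.toElem) (fun a 𝔭 => PrimarySupp a 𝔭) X)
    (hKfix : ∀ (A : D) (f : A ≅ A) (b : T.BΛ.obj (C₀.baseOp (op A)))
      (ξ : Algebra.GrothendieckGroup (C₀.Φ.carrier (op A))),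
      b ∈ T.FΛ (C₀.baseOp (op A)) → (b, ξ) ∈ C₀.ratFn (op A) → pullGp C₀.divisorMonoid f.hom ξ = ξ) :
    C₀.Thm37_ii F := fun hD hnd =>
  have hnd' : IsNonDilatingOn C₀.divisorMonoid := C₀.isNonDilatingOn_iff_pull.mpr hnd
  ⟨hStd (C₀.isOfStandardType_treeCatVocab hBmon hD hnd'),
    fun hr => hRS (C₀.thm37_ii_ratStd_treeCatVocab' hBmon hD hnd' (hRat hr) hKfix)⟩

/-- **AS TYPED at the reading slots, print's proof sentence DERIVED at `ℤ`-monoprime `Φ^{bs-fld}`** — residual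
{`hBmon`, `hLine`, `hInt`, `hZ`} (Def. 3.3 (iii) / 3.6 (i)–(ii)(a) data clauses only).
[cite: MochizukiEtTh2009, Thm 3.7 (ii) p.79] -/
theorem thm37_ii_of_slots_of_line (F : FrobenioidFacade.{u, v, w} D) (hBmon : IsMonoidOn C₀.ratFnFunctor)
    (hStd : (ModelFrobenioid.data C₀.divisorMonoid C₀.ratFnFunctor C₀.divBNatTrans).IsOfStandardType →
      F.IsOfStandardType C₀.toElem)
    (hRS : (PreFrobenioidData.ofFunctor C₀.divisorMonoid C₀.toElem).IsOfRationallyStandardType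
        (PreFrobenioid.rsParams (C₀.isFrobenioid_treeCatVocab_of_isMonoidOn hBmon) fun a 𝔭 => PrimarySupp a 𝔭) →
      F.IsOfRationallyStandardType C₀.toElem)
    (hRat : C₀.IsRational → ∀ X : C₀.category,
      PreFrobenioidData.IsRational
        (PreFrobenioid.biratData (C₀.isFrobenioid_treeCatVocab_of_isMonoidOn hBmon)
          (PreFrobenioid.hasBiratSquares_of_isFrobenioid (C₀.isFrobenioid_treeCatVocab_of_isMonoidOn hBmon)))
        (S := PreFrobenioidData.ofFunctor C₀.divisorMonoid C₀.toElem) (fun a 𝔭 => PrimarySupp a 𝔭) X)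
    (hLine : ∀ (Y : D₀ᵒᵖ) (g : Algebra.GrothendieckGroup (T.ΦR.obj Y)), g ∈ T.cnstR Y →
      ∃ r : T.ΦR.obj Y, g = Algebra.GrothendieckGroup.of r ∨ g = (Algebra.GrothendieckGroup.of r)⁻¹)
    (hInt : ∀ Y : D₀ᵒᵖ, IsCancelMul (T.ΦR.obj Y))
    (hZ : ∀ A : D, IsZMonoprime (C₀.bsFld.carrier (op A))) :
    C₀.Thm37_ii F :=
  C₀.thm37_ii_of_slots F hBmon hStd hRS hRat fun A =>
    C₀.pullGp_cnst_eq_self_of_line_of_isZMonoprime A hLine hInt (hZ A)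

/-- **AS TYPED at the reading slots from NAMED LAWS of the data** — `hBmon` ⟸ `TemperedFrobenioid.BaseInj` + the FSM
clause (`isMonoidOn_ratFnFunctor_of_baseInj'`), `hKfix` ⟸ {`hLine`, `hInt`, `hZ`}: the typed node `C₀.Thm37_ii F`
holds at every honest facade for every tempered Frobenioid over the canonical vocabularies whose Def. 3.3 (iii) /
3.6 (i)–(ii) data satisfy {`BaseInj`, FSM ⇒ iso, `hLine`, `hInt`, `ℤ`-monoprime `Φ^{bs-fld}`} — no other input.
[cite: MochizukiEtTh2009, Thm 3.7 (ii) p.79] -/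
theorem thm37_ii_of_slots_of_laws (F : FrobenioidFacade.{u, v, w} D) (hB : C₀.BaseInj)
    (hFSM : ∀ {A B : D} (α : B ⟶ A), IsFSM α → IsIso α)
    (hStd : (ModelFrobenioid.data C₀.divisorMonoid C₀.ratFnFunctor C₀.divBNatTrans).IsOfStandardType →
      F.IsOfStandardType C₀.toElem)
    (hRS : (PreFrobenioidData.ofFunctor C₀.divisorMonoid C₀.toElem).IsOfRationallyStandardType
        (PreFrobenioid.rsParams
          (C₀.isFrobenioid_treeCatVocab_of_isMonoidOn (C₀.isMonoidOn_ratFnFunctor_of_baseInj' hB hFSM))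
          fun a 𝔭 => PrimarySupp a 𝔭) →
      F.IsOfRationallyStandardType C₀.toElem)
    (hRat : C₀.IsRational → ∀ X : C₀.category,
      PreFrobenioidData.IsRational
        (PreFrobenioid.biratData
          (C₀.isFrobenioid_treeCatVocab_of_isMonoidOn (C₀.isMonoidOn_ratFnFunctor_of_baseInj' hB hFSM))
          (PreFrobenioid.hasBiratSquares_of_isFrobenioid
            (C₀.isFrobenioid_treeCatVocab_of_isMonoidOn (C₀.isMonoidOn_ratFnFunctor_of_baseInj' hB hFSM))))
        (S := PreFrobenioidData.ofFunctor C₀.divisorMonoid C₀.toElem) (fun a 𝔭 => PrimarySupp a 𝔭) X)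
    (hLine : ∀ (Y : D₀ᵒᵖ) (g : Algebra.GrothendieckGroup (T.ΦR.obj Y)), g ∈ T.cnstR Y →
      ∃ r : T.ΦR.obj Y, g = Algebra.GrothendieckGroup.of r ∨ g = (Algebra.GrothendieckGroup.of r)⁻¹)
    (hInt : ∀ Y : D₀ᵒᵖ, IsCancelMul (T.ΦR.obj Y))
    (hZ : ∀ A : D, IsZMonoprime (C₀.bsFld.carrier (op A))) :
    C₀.Thm37_ii F :=
  C₀.thm37_ii_of_slots_of_line F (C₀.isMonoidOn_ratFnFunctor_of_baseInj' hB hFSM) hStd hRS hRat hLine hInt hZ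

end AsTyped

end TemperedFrobenioid

end Literature.AnabelianGeometry.EtaleTheta
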